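import Literature.Computability.QuantumComplexity.ForrelationThm25Sign
import HarnessLib

/-!
# Aaronson–Ambainis Lemma 24 over the sign basis, II: realification with one extra wire

Second file of the discharge of `AaronsonAmbainis2018_lemma24_sign_hard` (plan in
`Lemma24Catalysis.lean`). The sign basis `{H, Z, CZ, CCZ}` computes real matrices; a complex
computation on `N` wires is simulated on `N + 1` wires by carrying real and imaginary parts on the
extra wire `ρ` (the LAST wire, `Fin.last N`; the original wires are `Fin.castSucc`): the standard
reduction of quantum computing to real amplitudes (Bernstein–Vazirani 1997, §8, proof that
amplitudes may be taken real; Adleman–DeMarrais–Huang 1997, §3; Aharonov 2003 / Shi 2003 for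
`{H, Toffoli}`): multiplication by `i` becomes the real quarter turn `J = [[0, -1], [1, 0]] = X Z`
on `ρ`.

* `vecEntry`, `blockEntry` — the `ℝ²`-coordinates of a complex number and the `2 × 2` real block
  `[[re, -im], [im, re]]` of multiplication by it; their algebra (`sum_blockEntry_mul_blockEntry`,
  `sum_blockEntry_mul_vecEntry`, additivity);
* `reVec Ψ` (real part on `ρ = 0`, imaginary part on `ρ = 1`) and `reOp U` (the block matrix);
  **`reOp_mul`**, `reOp_one`, **`reOp_mulVec_reVec : reOp U (reVec Ψ) = reVec (U Ψ)`**,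
  `reVec_basisState`, and the Born rule `norm_sq_reVec_false_add_true : Σ_ρ |reVec Ψ (z,ρ)|² = |Ψ z|²`,
  `sum_ite_norm_sq_reVec` (the weight of an event read off the original wires is unchanged);
* **`reOp_placeGate`**: realification commutes with placement (`reOp (placeGate e U) =
  placeGate (liftEmb e) (reOp U)`, the lifted embedding keeping `ρ` last), and
  **`reOp_placeGate_of_isRealMatrix`**: a real gate is realified by placing it verbatim
  (`H`, `X`, `Z`, `CZ`, `CCZ`, CNOT, Toffoli);
* the complex gate `S = diag(1, i)` of Clifford+`T`: **`reOp_sGate : reOp S = CNOT · CZ`** (on the data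
  wire and `ρ`; the library's `cnot`, `cz`), via `blockEntry_I` (`J = X Z`); the controlled-`S` gate of
  the injection word (`Lemma24Catalysis.lean`) realifies likewise to Toffoli `·` CCZ (sequel).

## References

* E. Bernstein, U. Vazirani, *Quantum complexity theory*, SIAM J. Comput. 26 (1997), §8.
* L. M. Adleman, J. DeMarrais, M.-D. A. Huang, *Quantum computability*, SIAM J. Comput. 26 (1997)
  1524–1540, §3 (real amplitudes suffice).
* D. Aharonov, *A simple proof that Toffoli and Hadamard are quantum universal*, arXiv:quant-ph/0301040
  (2003); Y. Shi, QIC 3 (2003) 84–92.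
* M. A. Nielsen, I. L. Chuang, *Quantum Computation and Quantum Information*, CUP 2010, §4.2, §4.3.
-/

noncomputable section

namespace Literature.Computability.QuantumComplexity

open Matrix _root_.Computability Complexity Cryptography Finset

namespace Lemma24

variable {N k : ℕ}

/-! ### Real coordinates of complex numbers -/

/-- The `ℝ²`-coordinates of `u ∈ ℂ`: `re u` at `false`, `im u` at `true` (as complex numbers).
[cite: BernsteinVazirani1997, §8] -/
def vecEntry (u : ℂ) : Bool → ℂ
  | false => (u.re : ℂ)
  | true => (u.im : ℂ)

/-- The real `2 × 2` block of multiplication by `u ∈ ℂ` on `ℝ² = ℂ`: `[[re, -im], [im, re]]`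
(row index first). [cite: BernsteinVazirani1997, §8] -/
def blockEntry (u : ℂ) : Bool → Bool → ℂ
  | false, false => (u.re : ℂ)
  | true, true => (u.re : ℂ)
  | true, false => (u.im : ℂ)
  | false, true => (-(u.im : ℂ))

/-- Block multiplication is complex multiplication. [cite: BernsteinVazirani1997, §8] -/
theorem sum_blockEntry_mul_blockEntry (u v : ℂ) (r s : Bool) :
    ∑ t : Bool, blockEntry u r t * blockEntry v t s = blockEntry (u * v) r s := by
  rw [Fintype.sum_bool]
  cases r <;> cases s <;> simp only [blockEntry, Complex.mul_re, Complex.mul_im] <;> push_cast <;> ring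

/-- The block acts on coordinates as complex multiplication. [cite: BernsteinVazirani1997, §8] -/
theorem sum_blockEntry_mul_vecEntry (u v : ℂ) (r : Bool) :
    ∑ t : Bool, blockEntry u r t * vecEntry v t = vecEntry (u * v) r := by
  rw [Fintype.sum_bool]
  cases r <;> simp only [blockEntry, vecEntry, Complex.mul_re, Complex.mul_im] <;> push_cast <;> ring

/-- `blockEntry` is additive. [folklore] -/
theorem blockEntry_sum {ι : Type*} (s : Finset ι) (f : ι → ℂ) (r t : Bool) :
    blockEntry (∑ i ∈ s, f i) r t = ∑ i ∈ s, blockEntry (f i) r t := by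
  cases r <;> cases t <;> simp only [blockEntry, Complex.re_sum, Complex.im_sum] <;> push_cast <;>
    simp [Finset.sum_neg_distrib]

/-- `vecEntry` is additive. [folklore] -/
theorem vecEntry_sum {ι : Type*} (s : Finset ι) (f : ι → ℂ) (r : Bool) :
    vecEntry (∑ i ∈ s, f i) r = ∑ i ∈ s, vecEntry (f i) r := by
  cases r <;> simp only [vecEntry, Complex.re_sum, Complex.im_sum] <;> push_cast <;> rfl

/-- The block of a real number `u` is `u · 1`. [folklore] -/
theorem blockEntry_of_im_eq_zero {u : ℂ} (hu : u.im = 0) (r s : Bool) :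
    blockEntry u r s = if r = s then u else 0 := by
  have hre : ((u.re : ℝ) : ℂ) = u := Complex.ext rfl (by simp [hu])
  cases r <;> cases s <;> simp [blockEntry, hu, hre]

/-- The block of `1`. [folklore] -/
theorem blockEntry_one (r s : Bool) : blockEntry 1 r s = if r = s then 1 else 0 :=
  blockEntry_of_im_eq_zero (by simp) r s

/-- The block of `0`. [folklore] -/
@[simp] theorem blockEntry_zero (r s : Bool) : blockEntry 0 r s = 0 := by
  cases r <;> cases s <;> simp [blockEntry]

/-- The coordinates of `0`. [folklore] -/
@[simp] theorem vecEntry_zero (r : Bool) : vecEntry 0 r = 0 := by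
  cases r <;> simp [vecEntry]

/-- **Born weights are preserved**: `|re u|² + |im u|² = |u|²`. [cite: BernsteinVazirani1997, §8] -/
theorem norm_sq_vecEntry_false_add_true (u : ℂ) :
    ‖vecEntry u false‖ ^ 2 + ‖vecEntry u true‖ ^ 2 = ‖u‖ ^ 2 := by
  simp only [vecEntry, Complex.norm_real, Real.norm_eq_abs, sq_abs, Complex.sq_norm, Complex.normSq_apply]
  ring

/-! ### Registers with the extra wire `ρ = Fin.last N` -/

/-- Every label of the enlarged register is `snoc` of its original part and its `ρ`-bit. [folklore] -/
theorem snoc_init_last (z : QReg (N + 1)) : Fin.snoc (Fin.init z) (z (Fin.last N)) = z :=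
  Fin.snoc_init_self z

/-- Sums over the enlarged register: over the `ρ`-bit and the original label. [folklore] -/
theorem sum_qReg_succ_snoc {M : Type*} [AddCommMonoid M] (F : QReg (N + 1) → M) :
    ∑ z, F z = ∑ t : Bool, ∑ z' : QReg N, F (Fin.snoc z' t) :=
  sum_tuple_succ F

/-! ### Realification of states and operators -/

/-- **Realification of a state**: real part on `ρ = 0`, imaginary part on `ρ = 1`.
[cite: BernsteinVazirani1997, §8] -/
def reVec (Ψ : QReg N → ℂ) : QReg (N + 1) → ℂ := fun z => vecEntry (Ψ (Fin.init z)) (z (Fin.last N))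

/-- **Realification of an operator**: the block matrix `[[Re U, -Im U], [Im U, Re U]]` with respect
to the wire `ρ`. [cite: BernsteinVazirani1997, §8] -/
def reOp (U : Matrix (QReg N) (QReg N) ℂ) : Matrix (QReg (N + 1)) (QReg (N + 1)) ℂ :=
  Matrix.of fun x y => blockEntry (U (Fin.init x) (Fin.init y)) (x (Fin.last N)) (y (Fin.last N))

/-- Entries of `reVec` at a `snoc` label. [folklore] -/
@[simp] theorem reVec_snoc (Ψ : QReg N → ℂ) (z' : QReg N) (t : Bool) :
    reVec Ψ (Fin.snoc z' t) = vecEntry (Ψ z') t := by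
  simp [reVec, Fin.init_snoc, Fin.snoc_last]

/-- Entries of `reOp` at `snoc` labels. [folklore] -/
@[simp] theorem reOp_snoc (U : Matrix (QReg N) (QReg N) ℂ) (x' y' : QReg N) (r s : Bool) :
    reOp U (Fin.snoc x' r) (Fin.snoc y' s) = blockEntry (U x' y') r s := by
  simp [reOp, Fin.init_snoc, Fin.snoc_last]

/-- Two matrices on the enlarged register agree iff they agree at all `snoc` labels. [folklore] -/
theorem matrix_ext_snoc {M M' : Matrix (QReg (N + 1)) (QReg (N + 1)) ℂ}
    (h : ∀ x' y' r s, M (Fin.snoc x' r) (Fin.snoc y' s) = M' (Fin.snoc x' r) (Fin.snoc y' s)) : M = M' := by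
  ext x y
  rw [← snoc_init_last x, ← snoc_init_last y]
  exact h _ _ _ _

/-- Two vectors on the enlarged register agree iff they agree at all `snoc` labels. [folklore] -/
theorem vec_ext_snoc {v v' : QReg (N + 1) → ℂ} (h : ∀ z' t, v (Fin.snoc z' t) = v' (Fin.snoc z' t)) :
    v = v' := by
  funext z
  rw [← snoc_init_last z]
  exact h _ _

/-- **Realification is multiplicative.** [cite: BernsteinVazirani1997, §8] -/
theorem reOp_mul (U V : Matrix (QReg N) (QReg N) ℂ) : reOp (U * V) = reOp U * reOp V := by
  refine matrix_ext_snoc fun x' y' r s => ?_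
  rw [Matrix.mul_apply, sum_qReg_succ_snoc, reOp_snoc, Matrix.mul_apply, blockEntry_sum, Finset.sum_comm]
  refine Finset.sum_congr rfl fun z' _ => ?_
  simp only [reOp_snoc]
  rw [sum_blockEntry_mul_blockEntry]

/-- Realification of the identity. [folklore] -/
theorem reOp_one : reOp (1 : Matrix (QReg N) (QReg N) ℂ) = 1 := by
  refine matrix_ext_snoc fun x' y' r s => ?_
  rw [reOp_snoc, Matrix.one_apply, Matrix.one_apply]
  by_cases h : x' = y'
  · subst h
    rw [if_pos rfl, blockEntry_one]
    by_cases hrs : r = s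
    · subst hrs; simp
    · rw [if_neg hrs, if_neg]
      intro h'
      exact hrs (by simpa using congrFun h' (Fin.last N))
  · rw [if_neg h, blockEntry_zero, if_neg]
    intro h'
    apply h
    funext i
    simpa using congrFun h' (Fin.castSucc i)

/-- Realification of a finite product of operators (the matrix of a circuit, factor by factor). [folklore] -/
theorem reOp_list_prod (l : List (Matrix (QReg N) (QReg N) ℂ)) : reOp l.prod = (l.map reOp).prod := by
  induction l with
  | nil => simp [reOp_one]
  | cons U l ih => rw [List.prod_cons, reOp_mul, ih, List.map_cons, List.prod_cons]

/-- **Realification intertwines the actions**: `reOp U (reVec Ψ) = reVec (U Ψ)`.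
[cite: BernsteinVazirani1997, §8] -/
theorem reOp_mulVec_reVec (U : Matrix (QReg N) (QReg N) ℂ) (Ψ : QReg N → ℂ) :
    reOp U *ᵥ reVec Ψ = reVec (U *ᵥ Ψ) := by
  refine vec_ext_snoc fun x' r => ?_
  rw [Matrix.mulVec, dotProduct, sum_qReg_succ_snoc, reVec_snoc, Matrix.mulVec, dotProduct, vecEntry_sum,
    Finset.sum_comm]
  refine Finset.sum_congr rfl fun z' _ => ?_
  simp only [reOp_snoc, reVec_snoc]
  rw [sum_blockEntry_mul_vecEntry]

/-- **Realification of a basis state** is the basis state with `ρ = 0`. [cite: BernsteinVazirani1997, §8] -/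
theorem reVec_basisState (w : QReg N) : reVec (basisState w) = basisState (Fin.snoc w false) := by
  refine vec_ext_snoc fun z' t => ?_
  rw [reVec_snoc, basisState_apply, basisState_apply]
  by_cases h : z' = w
  · subst h
    cases t
    · simp [vecEntry]
    · rw [if_pos rfl, if_neg]
      · simp [vecEntry]
      · intro h'; simpa using congrFun h' (Fin.last N)
  · rw [if_neg h, vecEntry_zero, if_neg]
    intro h'
    apply h
    simpa using congrArg Fin.init h'

/-- **Born weights on the enlarged register**: summing the two `ρ`-values recovers `|Ψ z|²`.
[cite: BernsteinVazirani1997, §8] -/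
theorem norm_sq_reVec_false_add_true (Ψ : QReg N → ℂ) (z' : QReg N) :
    ‖reVec Ψ (Fin.snoc z' false)‖ ^ 2 + ‖reVec Ψ (Fin.snoc z' true)‖ ^ 2 = ‖Ψ z'‖ ^ 2 := by
  rw [reVec_snoc, reVec_snoc, norm_sq_vecEntry_false_add_true]

/-- **The weight of an event read off the original wires is unchanged by realification**:
`Σ_{z} [E (init z)] |reVec Ψ z|² = Σ_{z'} [E z'] |Ψ z'|²`. [cite: BernsteinVazirani1997, §8] -/
theorem sum_ite_norm_sq_reVec (Ψ : QReg N → ℂ) (E : QReg N → Prop) [DecidablePred E] :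
    (∑ z : QReg (N + 1), if E (Fin.init z) then ‖reVec Ψ z‖ ^ 2 else 0) =
      ∑ z' : QReg N, if E z' then ‖Ψ z'‖ ^ 2 else 0 := by
  rw [sum_qReg_succ_snoc, Fintype.sum_bool, ← Finset.sum_add_distrib]
  refine Finset.sum_congr rfl fun z' _ => ?_
  simp only [Fin.init_snoc]
  split_ifs
  · rw [add_comm, norm_sq_reVec_false_add_true]
  · simp

/-! ### Realification and placement -/

/-- The lift of a wire embedding to the enlarged registers, keeping `ρ` last:
`castSucc i ↦ castSucc (e i)`, `last ↦ last`. [folklore] -/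
def liftEmb (e : Fin k ↪ Fin N) : Fin (k + 1) ↪ Fin (N + 1) :=
  ⟨fun i => Fin.lastCases (Fin.last N) (fun j => Fin.castSucc (e j)) i, by
    intro i j hij
    induction i using Fin.lastCases with
    | last =>
      induction j using Fin.lastCases with
      | last => rfl
      | cast j =>
        simp only [Fin.lastCases_last, Fin.lastCases_castSucc] at hij
        exact absurd hij.symm (Fin.castSucc_lt_last _).ne
    | cast i =>
      induction j using Fin.lastCases with
      | last =>
        simp only [Fin.lastCases_last, Fin.lastCases_castSucc] at hij
        exact absurd hij (Fin.castSucc_lt_last _).ne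
      | cast j =>
        simp only [Fin.lastCases_castSucc, Fin.castSucc_inj] at hij
        rw [e.injective hij]⟩

/-- `liftEmb e` on an original wire. [folklore] -/
@[simp] theorem liftEmb_castSucc (e : Fin k ↪ Fin N) (j : Fin k) : liftEmb e (Fin.castSucc j) = Fin.castSucc (e j) := by
  simp [liftEmb]

/-- `liftEmb e` on `ρ`. [folklore] -/
@[simp] theorem liftEmb_last (e : Fin k ↪ Fin N) : liftEmb e (Fin.last k) = Fin.last N := by
  simp [liftEmb]

/-- Restricting a `snoc` label along a lifted embedding. [folklore] -/
theorem snoc_comp_liftEmb (e : Fin k ↪ Fin N) (x' : QReg N) (r : Bool) :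
    (Fin.snoc x' r : QReg (N + 1)) ∘ liftEmb e = Fin.snoc (x' ∘ e) r := by
  funext i
  induction i using Fin.lastCases with
  | last => simp
  | cast j => simp

/-- The range of a lifted embedding: `ρ` and the images of the original range. [folklore] -/
theorem mem_range_liftEmb_iff (e : Fin k ↪ Fin N) (i : Fin (N + 1)) :
    i ∈ Set.range (liftEmb e) ↔ i = Fin.last N ∨ ∃ j, i = Fin.castSucc (e j) := by
  constructor
  · rintro ⟨l, rfl⟩
    induction l using Fin.lastCases with
    | last => exact Or.inl (liftEmb_last e)
    | cast j => exact Or.inr ⟨j, liftEmb_castSucc e j⟩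
  · rintro (rfl | ⟨j, rfl⟩)
    · exact ⟨Fin.last k, liftEmb_last e⟩
    · exact ⟨Fin.castSucc j, liftEmb_castSucc e j⟩

/-- Agreement off the lifted range is agreement of the original parts off the original range. [folklore] -/
theorem agree_off_liftEmb_iff (e : Fin k ↪ Fin N) (x' y' : QReg N) (r s : Bool) :
    (∀ i, i ∉ Set.range (liftEmb e) →
        Fin.snoc (α := fun _ => Bool) x' r i = Fin.snoc (α := fun _ => Bool) y' s i) ↔
      ∀ i, i ∉ Set.range e → x' i = y' i := by
  constructor
  · intro h i hi
    have := h (Fin.castSucc i) (by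
      rw [mem_range_liftEmb_iff]
      rintro (h' | ⟨j, hj⟩)
      · exact (Fin.castSucc_lt_last i).ne h'
      · exact hi ⟨j, (Fin.castSucc_injective _ hj).symm⟩)
    simpa using this
  · intro h i hi
    induction i using Fin.lastCases with
    | last => exact absurd (by rw [mem_range_liftEmb_iff]; exact Or.inl rfl) hi
    | cast j =>
      simp only [Fin.snoc_castSucc]
      exact h j fun ⟨l, hl⟩ => hi (by rw [mem_range_liftEmb_iff]; exact Or.inr ⟨l, by rw [hl]⟩)

/-- **Realification commutes with placement**: `reOp (placeGate e U) = placeGate (liftEmb e) (reOp U)`.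
[cite: NielsenChuang2010, §4.3] -/
theorem reOp_placeGate (e : Fin k ↪ Fin N) (U : Matrix (QReg k) (QReg k) ℂ) :
    reOp (placeGate e U) = placeGate (liftEmb e) (reOp U) := by
  refine matrix_ext_snoc fun x' y' r s => ?_
  rw [reOp_snoc, placeGate_apply, placeGate_apply, snoc_comp_liftEmb, snoc_comp_liftEmb, reOp_snoc]
  by_cases hag : ∀ i, i ∉ Set.range e → x' i = y' i
  · rw [if_pos hag, if_pos ((agree_off_liftEmb_iff e x' y' r s).2 hag)]
  · rw [if_neg hag, if_neg (fun h => hag ((agree_off_liftEmb_iff e x' y' r s).1 h)), blockEntry_zero]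

/-- **A real gate is realified by placing it verbatim** on the original wires.
[cite: BernsteinVazirani1997, §8] -/
theorem reOp_placeGate_of_isRealMatrix (e : Fin k ↪ Fin N) {U : Matrix (QReg k) (QReg k) ℂ}
    (hU : IsRealMatrix U) : reOp (placeGate e U) = placeGate (e.trans Fin.castSuccEmb) U := by
  refine matrix_ext_snoc fun x' y' r s => ?_
  rw [reOp_snoc, placeGate_apply, placeGate_apply, blockEntry_of_im_eq_zero]
  · have hrange : ∀ i : Fin (N + 1), i ∈ Set.range (e.trans Fin.castSuccEmb) ↔ ∃ j, i = Fin.castSucc (e j) := by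
      intro i
      simp only [Set.mem_range, Function.Embedding.trans_apply, Fin.coe_castSuccEmb]
      exact ⟨fun ⟨j, hj⟩ => ⟨j, hj.symm⟩, fun ⟨j, hj⟩ => ⟨j, hj.symm⟩⟩
    have hcx : (Fin.snoc x' r : QReg (N + 1)) ∘ (e.trans Fin.castSuccEmb) = x' ∘ e := by
      funext j; simp
    have hcy : (Fin.snoc y' s : QReg (N + 1)) ∘ (e.trans Fin.castSuccEmb) = y' ∘ e := by
      funext j; simp
    rw [hcx, hcy]
    by_cases hrs : r = s
    · subst hrs
      rw [if_pos rfl]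
      by_cases hag : ∀ i, i ∉ Set.range e → x' i = y' i
      · rw [if_pos hag, if_pos]
        intro i hi
        induction i using Fin.lastCases with
        | last => simp
        | cast j =>
          simp only [Fin.snoc_castSucc]
          exact hag j fun ⟨l, hl⟩ => hi ((hrange _).2 ⟨l, by rw [hl]⟩)
      · rw [if_neg hag, if_neg]
        intro h
        exact hag fun i hi => by
          simpa using h (Fin.castSucc i) (fun hm => by
            obtain ⟨j, hj⟩ := (hrange _).1 hm
            exact hi ⟨j, (Fin.castSucc_injective _ hj).symm⟩)
    · rw [if_neg hrs, if_neg]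
      intro h
      have := h (Fin.last N) (fun hm => by
        obtain ⟨j, hj⟩ := (hrange _).1 hm
        exact (Fin.castSucc_lt_last (e j)).ne hj.symm)
      exact hrs (by simpa using this)
  · split_ifs
    · exact hU _ _
    · rfl

/-! ### The two complex gates: `S` and controlled-`S` -/

/-- The real quarter turn `J = XZ = [[0, -1], [1, 0]]` (multiplication by `i` on `ℝ² = ℂ`) is the
product `X · Z` of the library's Pauli gates. [cite: BernsteinVazirani1997, §8] -/
theorem blockEntry_I (r s : Bool) : blockEntry Complex.I r s = (pauliX * pauliZ) (fun _ => r) (fun _ => s) := by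
  rw [Matrix.mul_apply, sum_qReg_one, Fintype.sum_bool]
  cases r <;> cases s <;> simp [blockEntry, pauliX, pauliZ, funext_iff]

/-- **Realification of `S = diag(1, i)`**: `reOp S = CNOT · CZ` on (data, `ρ`) — the controlled
quarter turn `J = XZ` (CZ first). [cite: BernsteinVazirani1997, §8] -/
theorem reOp_sGate : reOp sGate = cnot * cz := by
  refine matrix_ext_snoc fun x' y' r s => ?_
  rw [reOp_snoc, Matrix.mul_apply, sum_qReg_two]
  have hx : (Fin.snoc x' r : QReg 2) = ![x' 0, r] := by
    funext i; fin_cases i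
    · simp [Fin.snoc]
    · rfl
  have hy : (Fin.snoc y' s : QReg 2) = ![y' 0, s] := by
    funext i; fin_cases i
    · simp [Fin.snoc]
    · rfl
  have hx' : x' = fun _ => x' 0 := funext fun i => by rw [Subsingleton.elim i 0]
  have hy' : y' = fun _ => y' 0 := funext fun i => by rw [Subsingleton.elim i 0]
  rw [hx, hy, hx', hy']
  simp only [Fintype.sum_bool]
  cases x' 0 <;> cases y' 0 <;> cases r <;> cases s <;>
    simp [blockEntry, sGate, cnot, cz, funext_iff, Fin.forall_fin_one]

end Lemma24

end Literature.Computability.QuantumComplexity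

end
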